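import Literature.Computability.QuantumComplexity.GRMassTableClamp
import Literature.Computability.QuantumComplexity.GRTableMach
import HarnessLib

/-!
# The clamped table of the cosine machine on codes

Topic `Literature/Computability/QuantumComplexity`; sequel of `GRCosineCodeFP.lean` and `GRMassTableClamp.lean`.
The level code (`GRTableMach.LevelCode`) of the CLAMPED mass table `GRMassTable.tableTc`: the clamp point
`clampN`, the clamp `clampZ` and the clamped approximation `sGc` are polynomial time on codes; the machine
table `tableTc'` (division `2^ℓ/2^j` for `2^{ℓ−j}`, `max 1 (2^ℓ/2)` for `2^{ℓ−1}`) agrees with `tableTc` for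
`j ≤ ℓ`; and the level word of `tableTc'` is polynomial time (`codeFP_levelWordc`). Packaged:
**`LevelCode.clamp`**, so that `GRTableMach.mach LevelCode.clamp S p U k ℓ np hnp` is the machine datum of the
Grover–Rudolph block for the clamped table — whose accuracy budget `6(p+ℓ+3) ≤ U` does not depend on `S`
(`GRMassTable.accurate_tableTc`). Everything here is proved.

## References

* O. Regev, *On lattices, learning with errors, random linear codes, and cryptography*, J. ACM 56 (2009),
  art. 34, Lemma 3.12 (proof), §2 p. 11 [Regev2009].
* S. Arora, B. Barak, *Computational Complexity: A Modern Approach*, CUP 2009, §1.3 [AroraBarak2009].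
-/

noncomputable section

namespace Literature.Computability.QuantumComplexity

open Literature.Computability.Complexity Literature.Computability.Complexity.CodeFP
open _root_.Computability
open Literature.Algebra.EuclideanLattices (encodeRat)
open GaussianCells GRMassTable

namespace GRCosineCodeFP

/-! ### The clamp on codes -/

/-- **The clamp point on codes**: `(S, U) ↦ clampN S U` (`U` unary). [cite: Regev2009, §2 p. 11] -/
theorem codeFP_clampN : CodeFP (pairE encodeRat unE) natE (fun q => clampN q.1 q.2) := by
  have hS : CodeFP (pairE encodeRat unE) (pairE intE natE) (fun q => (q.1.num, q.1.den)) := (ratNumDen.comp (fst _ _) :)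
  have hU : CodeFP (pairE encodeRat unE) natE (fun q => q.2) := (natOfUn.comp (snd _ _) :)
  have hnum : CodeFP (pairE encodeRat unE) natE (fun q => q.1.num.natAbs) := (intNatAbs.comp hS.fst' :)
  have hden : CodeFP (pairE encodeRat unE) natE (fun q => 4 * q.1.den) := (natMul.comp ((const _ (4 : ℕ)).pair hS.snd') :)
  exact (natSqrt.comp (natDiv.comp ((natMul.comp (hU.pair hnum)).pair hden))).congr fun _ => rfl

/-- **The clamp on codes**: `(u₀, x) ↦ clampZ u₀ x`. [folklore] -/
theorem codeFP_clampZ : CodeFP (pairE natE intE) intE (fun q => clampZ q.1 q.2) := by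
  have hu : CodeFP (pairE natE intE) intE (fun q => (q.1 : ℤ)) := (intOfNat.comp (fst _ _) :)
  have hnu : CodeFP (pairE natE intE) intE (fun q => -(q.1 : ℤ)) := (intNeg.comp hu :)
  have hx : CodeFP (pairE natE intE) intE (fun q => q.2) := snd _ _
  have ht1 : CodeFP (pairE natE intE) bitE (fun q => decide ((q.1 : ℤ) ≤ q.2)) := (intLe.comp (hu.pair hx) :)
  have hm : CodeFP (pairE natE intE) intE (fun q => if decide ((q.1 : ℤ) ≤ q.2) then (q.1 : ℤ) else q.2) := ite ht1 hu hx
  have ht2 : CodeFP (pairE natE intE) bitE (fun q => decide (-(q.1 : ℤ) ≤ (if decide ((q.1 : ℤ) ≤ q.2) then (q.1 : ℤ) else q.2))) :=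
    (intLe.comp (hnu.pair hm) :)
  exact (ite ht2 hm hnu).congr fun q => by
    simp only [clampZ, min_def, max_def, decide_eq_true_eq]

/-- **The clamped signed approximation on codes**: `(params, x) ↦ sGc S p U x`. [cite: Regev2009, §2 p. 11] -/
theorem codeFP_sGc : CodeFP (pairE (pairE encodeRat (pairE unE unE)) intE) encodeRat (fun q => sGc q.1.1 q.1.2.1 q.1.2.2 q.2) := by
  have hS : CodeFP (pairE (pairE encodeRat (pairE unE unE)) intE) encodeRat (fun q => q.1.1) := (fst _ _).fst'
  have hp : CodeFP (pairE (pairE encodeRat (pairE unE unE)) intE) unE (fun q => q.1.2.1) := (fst _ _).snd'.fst'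
  have hU : CodeFP (pairE (pairE encodeRat (pairE unE unE)) intE) unE (fun q => q.1.2.2) := (fst _ _).snd'.snd'
  have hx : CodeFP (pairE (pairE encodeRat (pairE unE unE)) intE) intE (fun q => q.2) := snd _ _
  have hc : CodeFP (pairE (pairE encodeRat (pairE unE unE)) intE) intE (fun q => clampZ (clampN q.1.1 q.1.2.2) q.2) :=
    (codeFP_clampZ.comp ((codeFP_clampN.comp (hS.pair hU)).pair hx) :)
  exact (codeFP_sG.comp ((hS.pair ((unSucc.comp hp).pair hU)).pair hc)).congr fun _ => rfl

/-! ### The clamped table -/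

variable (S : ℚ) (p U : ℕ)

/-- **The clamped table computed by the machine**: as `tableTc` but with `2^ℓ / 2^j` for `2^{ℓ−j}` and
`max 1 (2^ℓ/2)` for `2^{ℓ−1}` (equal for `j ≤ ℓ`). [folklore] -/
def tableTc' (ℓ j h : ℕ) : ℚ :=
  sGc S p U (((h * (2 ^ ℓ / 2 ^ j) : ℕ) : ℤ) + ((2 ^ ℓ / 2 ^ j : ℕ) : ℤ) - ((max 1 (2 ^ ℓ / 2) : ℕ) : ℤ)) -
    sGc S p U (((h * (2 ^ ℓ / 2 ^ j) : ℕ) : ℤ) - ((max 1 (2 ^ ℓ / 2) : ℕ) : ℤ))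

variable {S p U}

/-- The machine's clamped table is the clamped mass table for `j ≤ ℓ`. [folklore] -/
theorem tableTc'_eq {ℓ j : ℕ} (hj : j ≤ ℓ) (h : ℕ) : tableTc' S p U ℓ j h = tableTc S p U ℓ j h := by
  have e1 : 2 ^ ℓ / 2 ^ j = 2 ^ (ℓ - j) := Nat.pow_div hj (by norm_num)
  have e2 : max 1 (2 ^ ℓ / 2) = 2 ^ (ℓ - 1) := by
    rcases Nat.eq_zero_or_pos ℓ with rfl | hℓ
    · simp
    · obtain ⟨m, rfl⟩ : ∃ m, ℓ = m + 1 := ⟨ℓ - 1, by omega⟩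
      rw [show 2 ^ (m + 1) / 2 = 2 ^ (m + 1 - 1) by rw [pow_succ, Nat.mul_div_cancel _ two_pos, Nat.add_sub_cancel],
        max_eq_right Nat.one_le_two_pow]
  unfold tableTc' tableTc hiZ loZ
  rw [e1, e2]
  push_cast
  ring_nf

/-- **The clamped table on codes**: `(params, (j, h)) ↦ tableTc' S p U ℓ j h`. [cite: Regev2009, Lemma 3.12 (proof)] -/
theorem codeFP_tableTc' : CodeFP inE encodeRat (fun q : LevelIn => tableTc' q.1.1.1 q.1.1.2.1 q.1.1.2.2 q.1.2.2 q.2.1 q.2.2) := by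
  have hpar : CodeFP inE (pairE encodeRat (pairE unE unE)) (fun q : LevelIn => q.1.1) := (fst _ _).fst'
  have hℓ : CodeFP inE unE (fun q : LevelIn => q.1.2.2) := (fst _ _).snd'.snd'
  have hj : CodeFP inE unE (fun q : LevelIn => q.2.1) := (snd _ _).fst'
  have hh : CodeFP inE natE (fun q : LevelIn => q.2.2) := (snd _ _).snd'
  have h2ℓ : CodeFP inE natE (fun q : LevelIn => 2 ^ q.1.2.2) := (pow2Un.comp hℓ :)
  have h2j : CodeFP inE natE (fun q : LevelIn => 2 ^ q.2.1) := (pow2Un.comp hj :)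
  have hw : CodeFP inE natE (fun q : LevelIn => 2 ^ q.1.2.2 / 2 ^ q.2.1) := (natDiv.comp (h2ℓ.pair h2j) :)
  have hhalf : CodeFP inE natE (fun q : LevelIn => max 1 (2 ^ q.1.2.2 / 2)) :=
    (natMax.comp ((const _ (1 : ℕ)).pair (natDiv.comp (h2ℓ.pair (const _ (2 : ℕ))))) :)
  have hlo0 : CodeFP inE natE (fun q : LevelIn => q.2.2 * (2 ^ q.1.2.2 / 2 ^ q.2.1)) := (natMul.comp (hh.pair hw) :)
  have hloZ : CodeFP inE intE (fun q : LevelIn => ((q.2.2 * (2 ^ q.1.2.2 / 2 ^ q.2.1) : ℕ) : ℤ) - ((max 1 (2 ^ q.1.2.2 / 2) : ℕ) : ℤ)) :=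
    (intSub.comp ((intOfNat.comp hlo0).pair (intOfNat.comp hhalf)) :)
  have hhiZ : CodeFP inE intE (fun q : LevelIn => ((q.2.2 * (2 ^ q.1.2.2 / 2 ^ q.2.1) : ℕ) : ℤ) + ((2 ^ q.1.2.2 / 2 ^ q.2.1 : ℕ) : ℤ) -
      ((max 1 (2 ^ q.1.2.2 / 2) : ℕ) : ℤ)) :=
    (intSub.comp ((intAdd.comp ((intOfNat.comp hlo0).pair (intOfNat.comp hw))).pair (intOfNat.comp hhalf)) :)
  have hsGhi : CodeFP inE encodeRat (fun q : LevelIn => sGc q.1.1.1 q.1.1.2.1 q.1.1.2.2 (((q.2.2 * (2 ^ q.1.2.2 / 2 ^ q.2.1) : ℕ) : ℤ) + ((2 ^ q.1.2.2 / 2 ^ q.2.1 : ℕ) : ℤ) -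
      ((max 1 (2 ^ q.1.2.2 / 2) : ℕ) : ℤ))) := (codeFP_sGc.comp (hpar.pair hhiZ) :)
  have hsGlo : CodeFP inE encodeRat (fun q : LevelIn => sGc q.1.1.1 q.1.1.2.1 q.1.1.2.2 (((q.2.2 * (2 ^ q.1.2.2 / 2 ^ q.2.1) : ℕ) : ℤ) - ((max 1 (2 ^ q.1.2.2 / 2) : ℕ) : ℤ))) :=
    (codeFP_sGc.comp (hpar.pair hloZ) :)
  exact (ratSub'.comp (hsGhi.pair hsGlo)).congr fun _ => rfl

/-! ### The level word of the clamped table -/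

/-- **The cosine numerator of the level of the clamped table on codes.** [cite: Regev2009, Lemma 3.12 (proof)] -/
theorem codeFP_levelAc : CodeFP inE natE (fun q : LevelIn =>
    aOf q.1.2.1 (tableTc' q.1.1.1 q.1.1.2.1 q.1.1.2.2 q.1.2.2 q.2.1 q.2.2) (tableTc' q.1.1.1 q.1.1.2.1 q.1.1.2.2 q.1.2.2 (q.2.1 + 1) (2 * q.2.2))) := by
  have hk : CodeFP inE unE (fun q : LevelIn => q.1.2.1) := (fst _ _).snd'.fst'
  have hpar : CodeFP inE parE (fun q : LevelIn => q.1) := fst _ _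
  have hj : CodeFP inE unE (fun q : LevelIn => q.2.1) := (snd _ _).fst'
  have hh : CodeFP inE natE (fun q : LevelIn => q.2.2) := (snd _ _).snd'
  have hshift : CodeFP inE inE (fun q : LevelIn => (q.1, (q.2.1 + 1, 2 * q.2.2))) :=
    (hpar.pair ((unSucc.comp hj).pair (natMul.comp ((const _ (2 : ℕ)).pair hh))) :)
  have hT0 : CodeFP inE encodeRat (fun q : LevelIn => tableTc' q.1.1.1 q.1.1.2.1 q.1.1.2.2 q.1.2.2 (q.2.1 + 1) (2 * q.2.2)) :=
    (codeFP_tableTc'.comp hshift :)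
  exact (codeFP_aOf.comp (hk.pair (codeFP_tableTc'.pair hT0))).congr fun _ => rfl

/-- **The cosine word of the level of the clamped table on codes.** [cite: Regev2009, Lemma 3.12 (proof) with §2 p. 11] -/
theorem codeFP_levelWordc : CodeFP inE strE (fun q : LevelIn =>
    wordOfNat q.1.2.1 (aOf q.1.2.1 (tableTc' q.1.1.1 q.1.1.2.1 q.1.1.2.2 q.1.2.2 q.2.1 q.2.2)
      (tableTc' q.1.1.1 q.1.1.2.1 q.1.1.2.2 q.1.2.2 (q.2.1 + 1) (2 * q.2.2)))) := by
  have hk : CodeFP inE unE (fun q : LevelIn => q.1.2.1) := (fst _ _).snd'.fst'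
  exact (codeFP_wordOfNat.comp (hk.pair codeFP_levelAc)).congr fun _ => rfl

end GRCosineCodeFP

/-- **The level code of the clamped table** `GRMassTable.tableTc`: the input of `GRTableMach` whose accuracy
budget is independent of `S`. [cite: Regev2009, Lemma 3.12 (proof) with §2 p. 11] -/
def LevelCode.clamp : LevelCode where
  tab := tableTc
  tab' := GRCosineCodeFP.tableTc'
  tab'_eq S p U _ _ hj h := GRCosineCodeFP.tableTc'_eq (S := S) (p := p) (U := U) hj h
  code := GRCosineCodeFP.codeFP_levelWordc

end Literature.Computability.QuantumComplexity

end
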